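import Literature.Probability.FitznerVanDerHofstad2017.NobleBoundsN1IotaXSpace
import Literature.Probability.FitznerVanDerHofstad2017.NobleBoundsN1Cls02DoublePrime
import Literature.Probability.FitznerVanDerHofstad2017.NobleBlocksDoublePrime
import HarnessLib

/-!
# [FvdH17] Lemma 5.3 at `N = 1` (the `ι`-bound) on the additive family `Ā''` (§6.1-typed row `(0,2)`)

The `''`-twin of the `ι`-chain `NobleBoundsN1IotaClasses` → `NobleBoundsN1IotaPartIII` → `NobleBoundsN1IotaReduce` →
`NobleBoundsN1IotaXSpace`, with the middle element `blockAbar''` of `NobleBlocksDoublePrime` (entry `(ι,0,2)` = the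
REPULSIVE triangle `𝓣_{1,1̲,0}` of §6.1 "Case a = 0, b ≥ 2", arXiv:1506.07977v2 p. 59, l.9918–9922 of the source).
§A–§B state the two landed reduction lemmas whose statements hard-wire `Ā'` ONCE over an arbitrary bounded middle
family `A` (proofs verbatim; the landed `Ā'` statements are the instances `A := blockAbar' L`); §C instantiates at
`A := blockAbar'' (Letters.perc d p)`: class `(0,2)` from `NobleBoundsN1Cls02DoublePrime.jointWitIota_cls_zero_two''` ∕
`jointWit_cls_zero_two''`, the other classes from the landed cell modules through `blockAbar''_of_ne`; §D sums over `x`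
((BoundXiIotaOne-1) on `(Ā''^ι) = matAbarIota''`, via `NobleBlocksDoublePrime` §F).  Every twin is re-proved in the
kernel; nothing is inherited from an `Ā'` theorem.  No named fact, no numeral, no dimension is fixed.
-/

noncomputable section

namespace Literature.Probability.FitznerVanDerHofstad2017

open _root_.MeasureTheory Literature.Barriers.CriticalPhenomena Literature.Probability.Percolation
open Literature.Probability.LatticeModels _root_.SimpleGraph
open Literature.Probability.FitznerVanDerHofstad2017.NobleBlocks
open Literature.Probability.FitznerVanDerHofstad2017.BlockSummation
open scoped ENNReal Matrix

variable {d : ℕ}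

/-! ## §A. (lemmapercboundXiiota1-1-step0) from class estimates, generic middle family `A` -/

/-- **[FvdH17] §6.1, the `x`-space bound on `Ξ^{(1),ι}_p(x)` from class estimates, for an ARBITRARY middle family `A`**
(the landed `nobleXiIotaT_one_le_blocks_of_cls` is the instance `A := blockAbar' L`; proof verbatim):
parts `I ∪ II` bounded class by class by `P^{ι,a} A^{κ,a,b} P^{E,b}`, part `III` by `A^{ι,0,b}(0,0,t,z) P^{E,b}`, give
`Ξ^{(1),ι}_T(x) ≤ Σ_{u,w,t,z} Σ_{κ,a,b} (δ_{a,0}δ_{ι,κ}𝟙{u=w=0} + P^{ι,a}(u,w)) A^{κ,a,b}(u,w,t,z) P^{E,b}(t−x,z−x)`.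
[cite: FitznerVanDerHofstad2017, §6.1 proof of Lemma 5.3, display (lemmapercboundXiiota1-1-step0) (arXiv:1506.07977v2 p. 59)] -/
theorem nobleXiIotaT_one_le_blocks_of_cls_of (L : Letters d)
    (A : Fin d × Bool → Fin 3 → Fin 3 → Site d → Site d → Site d → Site d → ℝ≥0∞) (p : unitInterval)
    (ι : Fin d × Bool) (x : Site d) (E : Site d → Site d → Site d → Site d → Site d → Set (Fin 2 → BondConfig (Site d)))
    (E₃ : Site d → Site d → Set (Fin 2 → BondConfig (Site d)))
    (h1 : nobleXiIotaT d p (stepVec ι) 1 x ≤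
      (∑' b : Site d × Site d, ∑' w : Site d, ∑' z : Site d, ∑' t : Site d,
        ENNReal.ofReal (bondJ d p (b.2 - b.1)) * piPerc d p 2 (E b.1 b.2 w z t)) +
      ∑' z : Site d, ∑' t : Site d, piPerc d p 2 (E₃ z t))
    (h2 : ∀ (a b : Fin 3) (u v w z t : Site d),
      ENNReal.ofReal (bondJ d p (v - u)) * piPerc d p 2 (E u v w z t ∩ clsSet u w t z a b) ≤
        ∑ κ : Fin d × Bool, (if v = u + stepVec κ then (1 : ℝ≥0∞) else 0) *
          (blockPiota L ι a u w * A κ a b u w t z * blockPE L b (t - x) (z - x)))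
    (h3 : ∀ (b : Fin 3) (z t : Site d), piPerc d p 2 (E₃ z t ∩ lineCls t z 1 b) ≤
      A ι 0 b 0 0 t z * blockPE L b (t - x) (z - x)) :
    nobleXiIotaT d p (stepVec ι) 1 x ≤ ∑' u, ∑' w, ∑' t, ∑' z, ∑ κ : Fin d × Bool, ∑ a : Fin 3, ∑ b : Fin 3,
      (kdeltaPref ι κ a u w + blockPiota L ι a u w) * A κ a b u w t z * blockPE L b (t - x) (z - x) := by
  -- the bond-summed part
  have hI : (∑' b : Site d × Site d, ∑' w : Site d, ∑' z : Site d, ∑' t : Site d,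
        ENNReal.ofReal (bondJ d p (b.2 - b.1)) * piPerc d p 2 (E b.1 b.2 w z t)) ≤
      ∑' u, ∑' w, ∑' t, ∑' z, ∑ κ : Fin d × Bool, ∑ a : Fin 3, ∑ b : Fin 3,
        blockPiota L ι a u w * A κ a b u w t z * blockPE L b (t - x) (z - x) := by
    refine le_tsum_blocks_of_pointwise _
      (fun u v w z t => ENNReal.ofReal (bondJ d p (v - u)) * piPerc d p 2 (E u v w z t))
      (fun κ a b u w t z => blockPiota L ι a u w * A κ a b u w t z * blockPE L b (t - x) (z - x))
      le_rfl ?_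
    intro u v w z t
    calc ENNReal.ofReal (bondJ d p (v - u)) * piPerc d p 2 (E u v w z t)
        ≤ ENNReal.ofReal (bondJ d p (v - u)) * ∑ a, ∑ b, piPerc d p 2 (E u v w z t ∩ clsSet u w t z a b) :=
          mul_le_mul' le_rfl (measure_le_sum_inter_clsSet _ _ u w t z)
      _ = ∑ a, ∑ b, ENNReal.ofReal (bondJ d p (v - u)) * piPerc d p 2 (E u v w z t ∩ clsSet u w t z a b) := by
          rw [Finset.mul_sum]; exact Finset.sum_congr rfl fun a _ => Finset.mul_sum _ _ _
      _ ≤ ∑ a, ∑ b, ∑ κ, (if v = u + stepVec κ then (1 : ℝ≥0∞) else 0) *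
            (blockPiota L ι a u w * A κ a b u w t z * blockPE L b (t - x) (z - x)) :=
          Finset.sum_le_sum fun a _ => Finset.sum_le_sum fun b _ => h2 a b u v w z t
  -- the bond-free part
  have hIII : (∑' z : Site d, ∑' t : Site d, piPerc d p 2 (E₃ z t)) ≤
      ∑' u, ∑' w, ∑' t, ∑' z, ∑ κ : Fin d × Bool, ∑ a : Fin 3, ∑ b : Fin 3,
        kdeltaPref ι κ a u w * (A κ a b u w t z * blockPE L b (t - x) (z - x)) := by
    calc (∑' z : Site d, ∑' t : Site d, piPerc d p 2 (E₃ z t))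
        ≤ ∑' z : Site d, ∑' t : Site d, ∑ b : Fin 3, A ι 0 b 0 0 t z * blockPE L b (t - x) (z - x) :=
          ENNReal.tsum_le_tsum fun z => ENNReal.tsum_le_tsum fun t =>
            (measure_le_sum_inter_lineCls _ _ t z 1).trans (Finset.sum_le_sum fun b _ => h3 b z t)
      _ = ∑' t : Site d, ∑' z : Site d, ∑ b : Fin 3, A ι 0 b 0 0 t z * blockPE L b (t - x) (z - x) :=
          ENNReal.tsum_comm
      _ ≤ _ := le_tsum_kdeltaPref_blocks ι (fun κ a b u w t z => A κ a b u w t z * blockPE L b (t - x) (z - x))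
  have hI' : (∑' b : Site d × Site d, ∑' w : Site d, ∑' z : Site d, ∑' t : Site d,
        ENNReal.ofReal (bondJ d p (b.2 - b.1)) * piPerc d p 2 (E b.1 b.2 w z t)) ≤
      ∑' u, ∑' w, ∑' t, ∑' z, ∑ κ : Fin d × Bool, ∑ a : Fin 3, ∑ b : Fin 3,
        blockPiota L ι a u w * (A κ a b u w t z * blockPE L b (t - x) (z - x)) := by
    simpa only [mul_assoc] using hI
  calc nobleXiIotaT d p (stepVec ι) 1 x ≤ _ := h1
    _ ≤ (∑' u, ∑' w, ∑' t, ∑' z, ∑ κ : Fin d × Bool, ∑ a : Fin 3, ∑ b : Fin 3,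
            kdeltaPref ι κ a u w * (A κ a b u w t z * blockPE L b (t - x) (z - x))) +
          ∑' u, ∑' w, ∑' t, ∑' z, ∑ κ : Fin d × Bool, ∑ a : Fin 3, ∑ b : Fin 3,
            blockPiota L ι a u w * (A κ a b u w t z * blockPE L b (t - x) (z - x)) := by
        rw [add_comm]; exact add_le_add hIII hI'
    _ = ∑' u, ∑' w, ∑' t, ∑' z, ∑ κ : Fin d × Bool, ∑ a : Fin 3, ∑ b : Fin 3,
          (kdeltaPref ι κ a u w + blockPiota L ι a u w) * (A κ a b u w t z * blockPE L b (t - x) (z - x)) :=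
        (tsum_blocks_add (fun κ a u w => kdeltaPref ι κ a u w) (fun _ a u w => blockPiota L ι a u w)
          (fun κ a b u w t z => A κ a b u w t z * blockPE L b (t - x) (z - x))).symm
    _ = _ := by simp only [mul_assoc]

/-! ## §B. The part-`III` class estimate from the class estimate `(0,b)` of `Ξ^{(1)}`, generic middle family `A` -/

/-- **Hypothesis `h3 b` from the class estimate `(0,b)` at `(u,v,w) = (0,e_ι,0)`, for an ARBITRARY middle family `A`**
(the landed `jointWitIII_cls_of` is the instance `A := blockAbar' (Letters.perc d p)`; proof verbatim):
`ℙ_p^{⊗2}(jointWitIII ∩ class b) ≤ A^{ι,0,b}(0,0,t,z) P^{E,b}(t−x,z−x)`.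
[cite: FitznerVanDerHofstad2017, §6.1 proof of Lemma 5.3, "If F^{ι,III}_0 occurs, then we have w=u=0 and κ=ι" (arXiv:1506.07977v2 p. 59)] -/
theorem jointWitIII_cls_of_of (A : Fin d × Bool → Fin 3 → Fin 3 → Site d → Site d → Site d → Site d → ℝ≥0∞)
    (p : unitInterval) (ι : Fin d × Bool) (x z t : Site d) (b : Fin 3)
    (h : ENNReal.ofReal (bondJ d p (stepVec ι - 0)) *
        piPerc d p 2 (jointWit 0 (stepVec ι) 0 z t x ∩ clsSet 0 0 t z 0 b) ≤
      ∑ κ : Fin d × Bool, (if stepVec ι = 0 + stepVec κ then (1 : ℝ≥0∞) else 0) *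
        (blockPS (Letters.perc d p) 0 0 0 * A κ 0 b 0 0 t z * blockPE (Letters.perc d p) b (t - x) (z - x))) :
    piPerc d p 2 (jointWitIII ι z t x ∩ lineCls t z 1 b) ≤ A ι 0 b 0 0 t z * blockPE (Letters.perc d p) b (t - x) (z - x) := by
  classical
  have hJ : ENNReal.ofReal (bondJ d p (stepVec ι - 0)) = ENNReal.ofReal p := by rw [sub_zero, bondJ_stepVec]
  have hL : piPerc d p 2 (jointWitIII ι z t x ∩ lineCls t z 1 b) =
      ENNReal.ofReal p * piPerc d p 2 (jointWit 0 (stepVec ι) 0 z t x ∩ clsSet 0 0 t z 0 b) := by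
    have h' := ofReal_mul_piPerc_preimage_eraseAt0 p (stepVec_mem_edgeSet ι)
      ((measurableSet_jointWit 0 (stepVec ι) 0 z t x).inter (measurableSet_clsSet 0 0 t z 0 b))
    rw [eraseAt0_preimage_jointWit_inter_clsSet] at h'
    rw [jointWitIII_inter_lineCls, h']
  have hR : (∑ κ : Fin d × Bool, (if stepVec ι = 0 + stepVec κ then (1 : ℝ≥0∞) else 0) *
        (blockPS (Letters.perc d p) 0 0 0 * A κ 0 b 0 0 t z * blockPE (Letters.perc d p) b (t - x) (z - x))) =
      A ι 0 b 0 0 t z * blockPE (Letters.perc d p) b (t - x) (z - x) := by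
    rw [Finset.sum_eq_single ι]
    · rw [if_pos (zero_add _).symm, one_mul, blockPS_zero_origin, one_mul]
    · intro κ _ hκ
      rw [if_neg, zero_mul]
      rw [zero_add]
      exact fun h => hκ (stepVec_injective' h).symm
    · exact fun h => absurd (Finset.mem_univ ι) h
  rw [hL, ← hJ, ← hR]
  exact h

/-! ## §C. The class estimates with the middle element `Ā''` -/

/-- **Part `III`, every class `b`, middle element `Ā''`**: `b = 0, 1` are the landed `Ā'` estimates (`blockAbar''_of_ne`),
`b = 2` is `jointWit_cls_zero_two''` (repulsive `𝓣_{1,1̲,0}`) through §B.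
[cite: FitznerVanDerHofstad2017, §6.1 proof of Lemma 5.3, "If F^{ι,III}_0 occurs …"; Case a = 0, b ≥ 2 (arXiv:1506.07977v2 p. 59)] -/
theorem jointWitIII_cls'' (p : unitInterval) (ι : Fin d × Bool) (x : Site d) :
    ∀ (b : Fin 3) (z t : Site d), piPerc d p 2 (jointWitIII ι z t x ∩ lineCls t z 1 b) ≤
      blockAbar'' (Letters.perc d p) ι 0 b 0 0 t z * blockPE (Letters.perc d p) b (t - x) (z - x) := by
  intro b z t
  by_cases h : (0 : Fin 3) = 0 ∧ b = 2
  · obtain ⟨-, rfl⟩ := h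
    exact jointWitIII_cls_of_of (blockAbar'' (Letters.perc d p)) p ι x z t 2
      (jointWit_cls_zero_two'' p x 0 (stepVec ι) 0 z t)
  · rw [blockAbar''_of_ne _ _ h]
    exact jointWitIII_cls p ι x b z t

/-- **Parts `I ∪ II`, all nine classes `(a,b)`, middle element `Ā''`**: class `(0,2)` is `jointWitIota_cls_zero_two''`,
every other class its landed `Ā'` estimate (`blockAbar''_of_ne`).
[cite: FitznerVanDerHofstad2017, §6.1 proof of Lemma 5.3, "Case a = 0 / a = 1 / a ≥ 2", "b = 1", "b = 2" (arXiv:1506.07977v2 pp. 58–59)] -/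
theorem jointWitIota_cls'' (p : unitInterval) (ι : Fin d × Bool) (x : Site d) :
    ∀ (a b : Fin 3) (u v w z t : Site d),
      ENNReal.ofReal (bondJ d p (v - u)) * piPerc d p 2 (jointWitIota ι x u v w z t ∩ clsSet u w t z a b) ≤
        ∑ κ : Fin d × Bool, (if v = u + stepVec κ then (1 : ℝ≥0∞) else 0) *
          (blockPiota (Letters.perc d p) ι a u w * blockAbar'' (Letters.perc d p) κ a b u w t z *
            blockPE (Letters.perc d p) b (t - x) (z - x)) := by
  intro a b u v w z t
  by_cases h : a = 0 ∧ b = 2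
  · obtain ⟨rfl, rfl⟩ := h
    exact jointWitIota_cls_zero_two'' p ι x u v w z t
  · simp_rw [blockAbar''_of_ne _ _ h]
    exact jointWitIota_cls p ι x a b u v w z t

/-! ## §D. The `x`-space bound and (BoundXiIotaOne-1) on `(Ā''^ι)` -/

/-- **[FvdH17] §6.1, display (lemmapercboundXiiota1-1-step0) with the middle element `Ā''`, hypothesis-free**:
`Ξ^{(1),ι}_T(x) ≤ Σ_{u,w,t,z} Σ_{κ,a,b} (δ_{a,0} δ_{ι,κ} 𝟙{u=w=0} + P^{ι,a}(u,w)) Ā''^{κ,a,b}(u,w,t,z) P^{E,b}(t−x,z−x)`.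
[cite: FitznerVanDerHofstad2017, §6.1 proof of Lemma 5.3, display (lemmapercboundXiiota1-1-step0) (arXiv:1506.07977v2 p. 59); (3.55) (p. 30)] -/
theorem nobleXiIotaT_one_le_blocks'' (p : unitInterval) (ι : Fin d × Bool) (x : Site d) :
    nobleXiIotaT d p (stepVec ι) 1 x ≤ ∑' u, ∑' w, ∑' t, ∑' z, ∑ κ : Fin d × Bool, ∑ a : Fin 3, ∑ b : Fin 3,
      (kdeltaPref ι κ a u w + blockPiota (Letters.perc d p) ι a u w) *
        blockAbar'' (Letters.perc d p) κ a b u w t z * blockPE (Letters.perc d p) b (t - x) (z - x) :=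
  nobleXiIotaT_one_le_blocks_of_cls_of (Letters.perc d p) (blockAbar'' (Letters.perc d p)) p ι x (jointWitIota ι x)
    (fun z t => jointWitIII ι z t x)
    ((nobleXiIotaT_one_le_add_partIII p ι x).trans
      (add_le_add (nobleXiBT_iota_one_le_tsum_pi_jointWitIota p ι x) le_rfl))
    (jointWitIota_cls'' p ι x) (jointWitIII_cls'' p ι x)

/-- **(BoundXiIotaOne-1), `ι`-averaged, in `[0,∞]`, on `(Ā''^ι)`**:
`(1/2d) Σ_ι Σ_x Ξ^{(1),ι}_T(x) ≤ P⃗^ι (Ā''^ι) P⃗^E` on the percolation letters (every `d`, every `p`).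
[cite: FitznerVanDerHofstad2017, Lemma 5.3 (BoundXiIotaOne-1) (arXiv:1506.07977v2 p. 50); §6.1 (p. 59); §5.1 `(P⃗^ι)_b` (p. 49)] -/
theorem invTwoD_mul_sum_tsum_nobleXiIotaT_one_le'' (p : unitInterval) :
    invTwoD d * ∑ ι : Fin d × Bool, ∑' x, nobleXiIotaT d p (stepVec ι) 1 x ≤
      vecPiota (Letters.perc d p) ᵥ* matAbarIota'' (Letters.perc d p) ⬝ᵥ vecPE (Letters.perc d p) :=
  invTwoD_mul_sum_tsum_le_vecPiota_matAbarIota''_vecPE (Letters.perc d p)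
    (fun ι x => nobleXiIotaT d p (stepVec ι) 1 x) fun ι x => nobleXiIotaT_one_le_blocks'' p ι x

/-- **[FvdH17] Lemma 5.3, first display (BoundXiIotaOne-1) at `N = 1`, on `(Ā''^ι)`, hypothesis-free**: for every fixed
direction `ι₀`, `Σ_x Ξ^{(1),ι₀}_p(x) ≤ P⃗^ι (Ā''^ι) P⃗^E` on the percolation letters (every `d`, every `p`).
[cite: FitznerVanDerHofstad2017, Lemma 5.3 (BoundXiIotaOne-1) (arXiv:1506.07977v2 p. 50); §6.1 proof of Lemma 5.3 (p. 59); §3.5 (p. 30)] -/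
theorem tsum_ofReal_nobleXiIotaN_one_le'' (p : unitInterval) (ι₀ : Fin d × Bool) :
    ∑' x, ENNReal.ofReal (nobleXiIotaN d p (stepVec ι₀) 1 x) ≤
      vecPiota (Letters.perc d p) ᵥ* matAbarIota'' (Letters.perc d p) ⬝ᵥ vecPE (Letters.perc d p) :=
  tsum_ofReal_nobleXiIotaN_le_vecPiota_matAbarIota''_vecPE (Letters.perc d p) p 1
    (fun ι x => ENNReal.ofReal_toReal_le.trans (nobleXiIotaT_one_le_blocks'' p ι x)) ι₀

/-! ## §E. Consistency: the landed `Ā'` reductions are the instances `A := blockAbar'` -/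

example (L : Letters d) : @nobleXiIotaT_one_le_blocks_of_cls d L =
    fun p ι x E E₃ h1 h2 h3 => nobleXiIotaT_one_le_blocks_of_cls_of L (blockAbar' L) p ι x E E₃ h1 h2 h3 := rfl

example (p : unitInterval) : @jointWitIII_cls_of d p =
    fun ι x z t b h => jointWitIII_cls_of_of (blockAbar' (Letters.perc d p)) p ι x z t b h := rfl

end Literature.Probability.FitznerVanDerHofstad2017

end
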